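import Summits.QuantumFields.YangMills.Theorems.BalabanUVNodesN08TrivialHistoryIteratedTransport

/-!
# BalabanUVNodes ∕ N08 — THE TRIVIAL HISTORY IS THE WORST HISTORY: print's iterated Radon–Nikodym history masses `MassesAC.massRecAC` are DOMINATED,
# `dU_k`-almost everywhere, by the TRIVIAL history's mass, `m_k(h,·) ≤ m_k(triv,·)`; and the least weakly-closed family of file 17 IS the trivial
# history's excess, `ν♯_k = (m_k(triv,·) − 1)·dU_k` EXACTLY — so the `k`-uniform mass letter of the [B10] slot is ONE statement about Haar and (15)

Track A, DAG node N08 = T. Bałaban, CMP **102** (1985) 255–275 [Balaban1985UV3]: (41) p. 266 (the history masses «Σ_{{Ω_j}} ∫dV_{k−1}↾_{Z_{k−1}} δ(V̄_{k−1}V^{−1}) ⋯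
χζ ⋯»), (47) p. 267 + p. 272 L32–33 (the trivial term «Ω_{k+1} = T_η»: NO characteristic function), (48) p. 268 (one transport step), (2) p. 256 («ρ_{k+1} = Tρ_k»),
Thm 1 (5) p. 257 (bounds extensive in `|T₁^{(k)}|`); the averaging (2) = [Balaban1985Averaging] (15) p. 19, the transformation (10) p. 19.  Cell `pub-ymgap`, width seat
`pub-ymgap-dag-n08-w1` (g6), W-SEAT-START-LIST §n08 item 1 successor piece (o22) = file 28; `--supports` K1⁹ `StabilityBRunRowsAtRecordR13SepCoPHV` (stmt-QuantumFields-27364,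
KEY MAP v2; helper).  Companion of files 16 (`…N08MassesACDominated`), 17 (`…N08MassesACLeastClosedFamily`: the least weakly-closed family `ν♯`), 23–24 (the
history-extensive letter), 25 (`…N08TrivialHistoryIteratedTransport`: `T_{k−1}⋯T_0 1 ≤ m_k(triv,·)`, NECESSITY of (a)′) and 27 (sufficiency up to `log(k+1)`).

THE POINT.  In the AC lane's bookkeeping the masses are `m_0 = 1`, `m_{k+1}(h) = T_k[w_k(h)·m_k(proj h)]` (admissible non-trivial `h`), `0` (inadmissible), and
`m_{k+1}(triv) = max 1 (T_k[w_k(triv)·m_k(triv)])` — with step weights `0 ≤ w_k(h) ≤ 1` (`Carriers.stepWeight_nonneg ∕ _le_one`) and `w_k(triv) = 1` identically in the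
standing range (`Carriers.stepWeight_triv`).  The transport `T_k` is monotone a.e. (file 25's `rnTransport_mono_ae`).  Hence, by induction on the level, **every history's mass is
dominated a.e. by the trivial history's mass** (§1): a non-trivial history only LOSES mass (its characteristic functions cut, nothing is floored), the trivial one only gains
(the floor).  Two consequences for the node's transport residual:
* the `k`-UNIFORM a.e. mass letter «`m_k(h,·) ≤ e^{c_m|T₁^{(k)}|}` for every history `h`» (file 15 ∕ III-b) is EQUIVALENT to the same letter at `h = triv` alone (§1), and the
  HISTORY-EXTENSIVE letter of files 23–24 FOLLOWS from it (its budget term is non-negative) — on the sufficiency side of this bookkeeping the history structure is idle;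
* the LEAST weakly-closed family `ν♯` of file 17 §4 (`ν♯_0 = 0`, `ν♯_{k+1} = (dU_k + ν♯_k)∘Ū_k⁻¹ − dU_{k+1}`) is, level by level, **`ν♯_k = (m_k(triv,·) − 1)·dU_k`** (§2: the floor
  `max 1 x = 1 + (x − 1)` IS Mathlib's truncated subtraction of measures) — so file 17 ∕ III-b's analytic target «`dν♯_k∕dU_k ≤ e^{c|T₁^{(k)}|} − 1` a.e.» is not merely sufficient
  but THE SAME STATEMENT as the letter at the trivial history (§2, `excessRec_le_withDensity_iff_massRecAC_triv_le_ae`).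
So the whole transport input of N08 in the GLOBAL-transport AC bookkeeping is ONE object with NO history structure: the FLOORED ITERATE of Haar under (15), `f_0 = 1`,
`f_{k+1} = max(1, T_k f_k)` (`= m_k(triv,·)`, `MassesAC.massRecAC_triv_succ`), to be bounded by `e^{c_m|T₁^{(k)}|}` `dU_k`-a.e., `k ≤ K`; (a)′ of file 25 is the same without the
floor (`T_{k−1}⋯T_0 1 ≤ f_k`).  §3 states everything at print's averaging `avOfPrint N S` on `SU(N)`.  The slot-facing corollary (`PrintedUV3V` ⟸ RunAlphaAC ∧ the letter at
`triv` ∧ window) is the companion file `…N08SlotOfRecordFromAlphaACTrivMassBound`.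

WHAT THIS FILE PROVES (kernel; theorems only, 0 def; [folklore] measure theory over the lane's DEFINED objects; nothing of the paper asserted).  For ANY averaging family `av` with
`AvgAC` at every level, ANY thresholds `M₁, Rcol, ε_L, ε_S`, in the standing range `k ≤ m + K + 1`:
* §1 ★★★ `massRecAC_le_triv_ae` — **`m_k(h,·) ≤ m_k(triv,·)` `dU_k`-a.e. for EVERY history `h`**; `massRecAC_le_ae_of_triv_le_ae` (any a.e. bound at `triv` holds at every history);
  `massBound_all_iff_triv` (the uniform letter ∀h ⟺ at `triv`); `massBoundZ_ae_of_massBound_triv_ae` (files 23–24's history-extensive antecedent ⟸ the letter at `triv`, any budget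
  `β ≥ 0`); `withDensity_massRecAC_le_triv` (measure currency).
* §1b ★★ `massRecAC_triv_le_ae_of_supersolution` ∕ `massRecAC_le_ae_of_supersolution` — THE COMPARISON PRINCIPLE: integrable `g_j ≥ 1` with `T_j g_j ≤ g_{j+1}` a.e. (`j < k`)
  dominate `m_k(triv,·)`, hence every history's mass, a.e. — the usable form of any future proof of the letter; constant extensive profiles are never supersolutions (docstring).
* §2 ★★★ `withDensity_massRecAC_triv_eq_add_excessRec` — **`m_k(triv,·)·dU_k = dU_k + ν♯_k`** for every excess-recursive family `νs` of file 17 §4 (`withDensity_rnTransport_eq_pushDensity`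
  of file 25, `Measure.withDensity_sub`, `1 + (x − 1) = max 1 x`); `excessRec_eq_withDensity_massRecAC_triv_sub_one` (`ν♯_k = dU_k.withDensity (m_k(triv,·) − 1)`);
  ★★ `excessRec_le_withDensity_iff_massRecAC_triv_le_ae` (`ν♯_k ≤ B·dU_k ⟺ m_k(triv,·) ≤ 1 + B` a.e.); `excessRec_le_smul_iff_massRecAC_triv_le_exp_ae` (the extensive form:
  `ν♯_k ≤ (e^{c} − 1)·dU_k ⟺ m_k(triv,·) ≤ e^{c}` a.e.); `withDensity_massRecAC_le_withDensity_triv` (file 17 §2 at `ν♯` recovers §1 in measure currency — consistency);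
  ★ `lintegral_massRecAC_triv_le` — IN `L¹` THERE IS NO STACKING: `∫ m_k(triv) dU_k ≤ 1 + Σ_{j<k} ‖(dU_j∘Ū_j⁻¹ − dU_{j+1})⁺‖` (the one-step excess masses add up; the letter is about the sup).
* §3 at the [B10] slot's averaging `avOfPrint N S` (SU(N), every `N`, `k ≤ K + 1`): `massRecAC_avOfPrint_le_triv_ae`, `massBound_avOfPrint_all_iff_triv`,
  `withDensity_massRecAC_triv_avOfPrint_eq_add_excessRec`, `excessRec_avOfPrint_le_smul_iff_triv_le_exp_ae`.

LOCATED READING (R4¹¹) (count-neutral; plan ∕ node00-def ∕ pub-balaban3d ∕ the n08-w3∕w6 analysis lineage decide).  g5's (R4⁷) «the letter may be history-extensive» is never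
NEEDED on the sufficiency side of this bookkeeping (it stays available: files 23–24 stand); the bracket (R4⁸)–(R4⁹) sharpens to an EXACT residual: in AC currency N08's transport
input = «the floored Haar iterate `f_k` under (15) obeys `f_k ≤ e^{c_m|T₁^{(k)}|}` `dU_k`-a.e., `k ≤ K`» — NECESSARY (it is `m_k(triv,·)`) and SUFFICIENT (companion file, via
III-b).  Whether it HOLDS for (15) is the no-stacking question of `N08-EML-JACOBIAN.md` §4 with the floor; nothing here decides it.  Road (i) of (R4¹⁰) (Z-local masses) untouched.

HONEST FRAMING: count-neutral helper; no bound on the floored iterate is claimed — (a)′ and E6′ NOT decided; `hmass` NOT supplied; `PrintedUV3V` NOT proved; N08 NOT discharged;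
one finite 𝕋⁴ programme at fixed ε, Bałaban AS PRINTED — R4 closes the conditional finite-𝕋⁴ rung `BalabanLadder.UV` only; the Yang–Mills mass gap (Clay) is NOT proved by any
of this; nothing continuum ∕ ℝ⁴ ∕ OS.  No `sorry`, standard axioms.
-/

noncomputable section

open MeasureTheory
open scoped ENNReal

namespace Summit.QuantumFields.YangMills.BalabanUVNodes.N08TrivialHistoryDominates

open Literature.MathematicalPhysics.QuantumFieldTheory.Balaban1983to89
open Literature.MathematicalPhysics.QuantumFieldTheory.Balaban1983to89.AveragingRT (rnTransport pushDensity rnTransport_nonneg)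
open Summit.QuantumFields.Balaban3D.Carriers
open Summit.QuantumFields.Balaban3D.Proofs.MassesAC
open Summit.QuantumFields.YangMills.BalabanUVNodes.N08MassesACDominated (rnDeriv_le_of_le_withDensity)
open Summit.QuantumFields.YangMills.BalabanUVNodes.N08MassesACLeastClosedFamily (withDensity_massRecAC_le_of_weakClosed weakClosed_of_excessRec
  isFiniteMeasure_of_excessRec excessRec_univ_le)
open Summit.QuantumFields.YangMills.BalabanUVNodes.N08TrivialHistoryIteratedTransport (rnTransport_mono_ae withDensity_rnTransport_eq_pushDensity)

/-! ## §1 The trivial history dominates every history, almost everywhere -/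
section Dominates

variable {P : Params} {G : Type} [GaugeGroup G] [MeasurableSpace G] [HaarData G] [RegularGaugeGroup G]
  (M₁ : ℕ) (Rcol : ℕ → ℕ) (εL εS : ℕ → ℝ) (av : ∀ j, Averaging P j G) (hav : ∀ j, AvgAC (av j).avg)
include hav

open Classical in
/-- ★★★ **THE TRIVIAL HISTORY IS THE WORST HISTORY: `m_k(h,·) ≤ m_k(triv,·)` `dU_k`-a.e. for EVERY history `h`** of level `k ≤ m + K + 1` (the standing range, where the
trivial history's step weights are `1` identically — `Carriers.stepWeight_triv`).  Induction on the level over the three cases of `MassesAC.massRecAC`: `m_0 ≡ 1`; inadmissible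
`h`: `0 ≤ m(triv)`; admissible non-trivial `h`: `m_{k+1}(h) = T_k[w_k(h)·m_k(proj h)] ≤ T_k[m_k(proj h)] ≤ T_k[m_k(triv)]` a.e. (`w ≤ 1`, the induction hypothesis at `proj h`,
monotonicity of the transport a.e. — file 25's `rnTransport_mono_ae`, masses integrable) `= T_k[w_k(triv)·m_k(triv)] ≤ max 1 (…) = m_{k+1}(triv)`.  A non-trivial history only
LOSES mass (characteristic functions `ζ`, `χ` cut; no floor), the trivial one only gains (the (47)-floor). [cite: Balaban1985UV3, (41) p.266 + (47) p.267 + (48) p.268 (the masses; bookkeeping); Balaban1985Averaging, (10) p.19] -/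
theorem massRecAC_le_triv_ae : ∀ k, k ≤ P.m + P.K + 1 → ∀ h : Hist P k,
    massRecAC M₁ Rcol εL εS av k h ≤ᵐ[fieldMeasure P k G] massRecAC M₁ Rcol εL εS av k (Hist.triv P k)
  | 0, _, h => Filter.Eventually.of_forall fun V => by rw [massRecAC_zero, massRecAC_zero]
  | k + 1, hk, h => by
    by_cases ht : h = Hist.triv P (k + 1)
    · subst ht
      exact Filter.Eventually.of_forall fun _ => le_rfl
    by_cases hh : Hist.Admissible M₁ Rcol (k + 1) h
    · -- admissible non-trivial: the exact transport of `w_k(h)·m_k(proj h) ≤ m_k(proj h) ≤ m_k(triv)` a.e.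
      have ih := massRecAC_le_triv_ae k (by omega) h.proj
      have hf0 : ∀ U, 0 ≤ stepWeight M₁ Rcol εL εS k h U * massRecAC M₁ Rcol εL εS av k h.proj U := fun U =>
        mul_nonneg (stepWeight_nonneg M₁ Rcol εL εS k h U) (massRecAC_nonneg M₁ Rcol εL εS av k _ U)
      have hle : (fun U => stepWeight M₁ Rcol εL εS k h U * massRecAC M₁ Rcol εL εS av k h.proj U) ≤ᵐ[fieldMeasure P k G]
          massRecAC M₁ Rcol εL εS av k (Hist.triv P k) := by
        filter_upwards [ih] with U hU
        have hw := stepWeight_le_one M₁ Rcol εL εS k h U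
        have hw0 := stepWeight_nonneg M₁ Rcol εL εS k h U
        have hm := massRecAC_nonneg M₁ Rcol εL εS av k h.proj U
        calc stepWeight M₁ Rcol εL εS k h U * massRecAC M₁ Rcol εL εS av k h.proj U
            ≤ 1 * massRecAC M₁ Rcol εL εS av k h.proj U := mul_le_mul_of_nonneg_right hw hm
          _ = massRecAC M₁ Rcol εL εS av k h.proj U := one_mul _
          _ ≤ massRecAC M₁ Rcol εL εS av k (Hist.triv P k) U := hU
      have hmono := rnTransport_mono_ae (hav k) hf0 (fun V => massRecAC_nonneg M₁ Rcol εL εS av k _ V) hle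
        (integrable_massRecAC M₁ Rcol εL εS av k (Hist.triv P k))
      have hw1 : (fun U => stepWeight M₁ Rcol εL εS k (Hist.triv P (k + 1)) U * massRecAC M₁ Rcol εL εS av k (Hist.triv P k) U) =
          massRecAC M₁ Rcol εL εS av k (Hist.triv P k) :=
        funext fun U => by rw [stepWeight_triv M₁ Rcol εL εS (by omega) U, one_mul]
      filter_upwards [hmono] with V hV
      rw [massRecAC_succ M₁ Rcol εL εS av k h hh ht V, massRecAC_triv_succ, hw1]
      exact hV.trans (le_max_right _ _)
    · -- inadmissible: mass `0`
      exact Filter.Eventually.of_forall fun V => by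
        rw [massRecAC_eq_zero_of_not_admissible M₁ Rcol εL εS av (k + 1) h V hh]
        exact massRecAC_nonneg M₁ Rcol εL εS av (k + 1) _ V

/-- ★★ **ANY a.e. BOUND AT THE TRIVIAL HISTORY HOLDS AT EVERY HISTORY**: `m_k(triv,·) ≤ B` `dU_k`-a.e. ⇒ `m_k(h,·) ≤ B` `dU_k`-a.e. for every `h` (`k ≤ m + K + 1`).
[cite: Balaban1985UV3, (41) p.266 + (47) p.267 (bookkeeping)] -/
theorem massRecAC_le_ae_of_triv_le_ae {k : ℕ} (hk : k ≤ P.m + P.K + 1) {B : GaugeField P k G → ℝ}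
    (hB : ∀ᵐ V ∂(fieldMeasure P k G), massRecAC M₁ Rcol εL εS av k (Hist.triv P k) V ≤ B V) (h : Hist P k) :
    ∀ᵐ V ∂(fieldMeasure P k G), massRecAC M₁ Rcol εL εS av k h V ≤ B V := by
  filter_upwards [massRecAC_le_triv_ae M₁ Rcol εL εS av hav k hk h, hB] with V h1 h2
  exact h1.trans h2

/-- ★★ **THE HISTORY-UNIFORM a.e. MASS LETTER IS EQUIVALENT TO THE LETTER AT THE TRIVIAL HISTORY**: for any bound `B` and level `k ≤ m + K + 1`,
«`m_k(h,·) ≤ B` a.e. for every history `h`» ⟺ «`m_k(triv,·) ≤ B` a.e.» — the history structure is IDLE on the sufficiency side of this bookkeeping. [cite: Balaban1985UV3, (41) p.266 + (5) p.257 (the uniform extensive shape; bookkeeping)] -/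
theorem massBound_all_iff_triv {k : ℕ} (hk : k ≤ P.m + P.K + 1) (B : GaugeField P k G → ℝ) :
    (∀ h : Hist P k, ∀ᵐ V ∂(fieldMeasure P k G), massRecAC M₁ Rcol εL εS av k h V ≤ B V) ↔
      ∀ᵐ V ∂(fieldMeasure P k G), massRecAC M₁ Rcol εL εS av k (Hist.triv P k) V ≤ B V :=
  ⟨fun H => H _, fun H h => massRecAC_le_ae_of_triv_le_ae M₁ Rcol εL εS av hav hk H h⟩

/-- ★★ **THE HISTORY-EXTENSIVE LETTER OF FILES 23–24 FOLLOWS FROM THE LETTER AT THE TRIVIAL HISTORY**: «`m_k(triv,·) ≤ e^{c}` a.e.» ⇒ «`m_k(h,·) ≤ exp(c + β·Σ_{j<k}|Z_j(h)|)` a.e.»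
for every history `h` and every budget `β ≥ 0` (the budget term is non-negative; `k ≤ m + K + 1`) — the printed Z-terms are never NEEDED to pay for a history's past in this
bookkeeping (they may still be USED: files 23–24 stand). [cite: Balaban1985UV3, (41) p.266 (the Z-terms «+ Σ_{j=0}^{k−1} O(log g_j⁻¹)|Z_j|»; bookkeeping)] -/
theorem massBoundZ_ae_of_massBound_triv_ae {k : ℕ} (hk : k ≤ P.m + P.K + 1) (c β : ℝ) (hβ : 0 ≤ β)
    (hm : ∀ᵐ V ∂(fieldMeasure P k G), massRecAC M₁ Rcol εL εS av k (Hist.triv P k) V ≤ Real.exp c) (h : Hist P k) :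
    ∀ᵐ V ∂(fieldMeasure P k G), massRecAC M₁ Rcol εL εS av k h V ≤
      Real.exp (c + β * ∑ j ∈ Finset.range k, (ZVol M₁ Rcol k h j : ℝ)) := by
  have hbud : 0 ≤ β * ∑ j ∈ Finset.range k, (ZVol M₁ Rcol k h j : ℝ) :=
    mul_nonneg hβ (Finset.sum_nonneg fun j _ => Nat.cast_nonneg _)
  filter_upwards [massRecAC_le_ae_of_triv_le_ae M₁ Rcol εL εS av hav hk hm h] with V hV
  exact hV.trans (Real.exp_le_exp.2 (by linarith))

/-- **MEASURE CURRENCY: `m_k(h,·)·dU_k ≤ m_k(triv,·)·dU_k`** for every history (`withDensity_mono` on §1). [cite: Balaban1985UV3, (41) p.266 (bookkeeping)] -/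
theorem withDensity_massRecAC_le_triv {k : ℕ} (hk : k ≤ P.m + P.K + 1) (h : Hist P k) :
    (fieldMeasure P k G).withDensity (fun V => ENNReal.ofReal (massRecAC M₁ Rcol εL εS av k h V)) ≤
      (fieldMeasure P k G).withDensity (fun V => ENNReal.ofReal (massRecAC M₁ Rcol εL εS av k (Hist.triv P k) V)) :=
  withDensity_mono ((massRecAC_le_triv_ae M₁ Rcol εL εS av hav k hk h).mono fun _ hV => ENNReal.ofReal_le_ofReal hV)

/-! ### §1b The comparison principle: every SUPERSOLUTION dominates the trivial history's mass (the floored iterate) -/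

omit [RegularGaugeGroup G] in
/-- ★★ **COMPARISON PRINCIPLE FOR THE FLOORED ITERATE**: if measurable integrable functions `g_j ≥ 1` satisfy `T_j g_j ≤ g_{j+1}` `dU_{j+1}`-a.e. for `j < k` (a SUPERSOLUTION of the
recursion `f_{j+1} = max(1, T_j f_j)` along the averaging family), then `m_k(triv,·) ≤ g_k` `dU_k`-a.e. (`k ≤ m + K + 1`; induction with `rnTransport_mono_ae`: `max(1, T_j m_j(triv)) ≤
max(1, T_j g_j) ≤ g_{j+1}`).  With §1 the same `g_k` bounds EVERY history's mass.  This is the function-currency form of file 17 §2 at absolutely continuous families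
`ν_j = (g_j − 1)·dU_j`; it is how a proof of the node's transport letter would be USED.  NOTE (located): a CONSTANT profile `g_j ≡ e^{c_j}` is a supersolution iff
`e^{c_j}·T_j 1 ≤ e^{c_{j+1}}` a.e., i.e. `c_{j+1} ≥ c_j + log ‖T_j 1‖_∞` — the stacking bound; the extensive profile `c_j = c_m|T₁^{(j)}|` DECREASES in `j`, so it is never a constant
supersolution (`T_j 1` has `dU_{j+1}`-mean `1`): any proof of the letter must use NON-constant comparison functions, i.e. WHERE the transported density is large.
[cite: Balaban1985UV3, (41) p.266 + (47) p.267 + (2) p.256 (bookkeeping); Balaban1985Averaging, (10) p.19] -/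
theorem massRecAC_triv_le_ae_of_supersolution (g : ∀ j, GaugeField P j G → ℝ) (hg1 : ∀ j U, 1 ≤ g j U)
    (hgi : ∀ j, Integrable (g j) (fieldMeasure P j G))
    (hsuper : ∀ j, rnTransport (av j).avg (g j) ≤ᵐ[fieldMeasure P (j + 1) G] g (j + 1)) :
    ∀ k, k ≤ P.m + P.K + 1 → massRecAC M₁ Rcol εL εS av k (Hist.triv P k) ≤ᵐ[fieldMeasure P k G] g k
  | 0, _ => Filter.Eventually.of_forall fun V => by rw [massRecAC_zero]; exact hg1 0 V
  | k + 1, hk => by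
    have ih := massRecAC_triv_le_ae_of_supersolution g hg1 hgi hsuper k (by omega)
    have hg0 : ∀ U, 0 ≤ g k U := fun U => zero_le_one.trans (hg1 k U)
    have hmono := rnTransport_mono_ae (hav k) (fun V => massRecAC_nonneg M₁ Rcol εL εS av k _ V) hg0 ih (hgi k)
    have hw1 : (fun U => stepWeight M₁ Rcol εL εS k (Hist.triv P (k + 1)) U * massRecAC M₁ Rcol εL εS av k (Hist.triv P k) U) =
        massRecAC M₁ Rcol εL εS av k (Hist.triv P k) :=
      funext fun U => by rw [stepWeight_triv M₁ Rcol εL εS (by omega) U, one_mul]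
    filter_upwards [hmono, hsuper k] with V hV hS
    rw [massRecAC_triv_succ, hw1]
    exact max_le (hg1 (k + 1) V) (hV.trans hS)

/-- ★★ **… hence a supersolution bounds EVERY history's mass**: `g_j ≥ 1` integrable, `T_j g_j ≤ g_{j+1}` a.e. ⇒ `m_k(h,·) ≤ g_k` `dU_k`-a.e. for every `h` (`k ≤ m + K + 1`; §1 + §1b).
In particular the node's letter «`m_k(h,·) ≤ e^{c_m|T₁^{(k)}|}` a.e. ∀h, `k ≤ K`» follows from ANY supersolution `g` with `g_k ≤ e^{c_m|T₁^{(k)}|}` a.e. [cite: Balaban1985UV3, (41) p.266 + (5) p.257 (bookkeeping); Balaban1985Averaging, (10) p.19] -/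
theorem massRecAC_le_ae_of_supersolution (g : ∀ j, GaugeField P j G → ℝ) (hg1 : ∀ j U, 1 ≤ g j U)
    (hgi : ∀ j, Integrable (g j) (fieldMeasure P j G))
    (hsuper : ∀ j, rnTransport (av j).avg (g j) ≤ᵐ[fieldMeasure P (j + 1) G] g (j + 1))
    {k : ℕ} (hk : k ≤ P.m + P.K + 1) (h : Hist P k) :
    massRecAC M₁ Rcol εL εS av k h ≤ᵐ[fieldMeasure P k G] g k :=
  massRecAC_le_ae_of_triv_le_ae M₁ Rcol εL εS av hav hk (massRecAC_triv_le_ae_of_supersolution M₁ Rcol εL εS av hav g hg1 hgi hsuper k hk) h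

end Dominates

/-! ## §2 The least weakly-closed family IS the trivial history's excess: `ν♯_k = (m_k(triv,·) − 1)·dU_k` -/
section Cancel

variable {α : Type*} [MeasurableSpace α] {μ ν₁ ν₂ : Measure α}

/-- Cancellation of a finite measure on the left of an inequality of measures: `μ + ν₁ ≤ μ + ν₂ ⇒ ν₁ ≤ ν₂` (`μ` finite; setwise `ℝ≥0∞` cancellation). [folklore] -/
theorem le_of_add_le_add_left_measure [IsFiniteMeasure μ] (h : μ + ν₁ ≤ μ + ν₂) : ν₁ ≤ ν₂ := by
  refine Measure.le_iff.2 fun s hs => ?_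
  have h1 := Measure.le_iff.1 h s hs
  rw [Measure.add_apply, Measure.add_apply] at h1
  exact (ENNReal.add_le_add_iff_left (measure_ne_top μ s)).1 h1

end Cancel

section Excess

variable {P : Params} {G : Type} [GaugeGroup G] [MeasurableSpace G] [HaarData G] [RegularGaugeGroup G]
  (M₁ : ℕ) (Rcol : ℕ → ℕ) (εL εS : ℕ → ℝ) {av : ∀ j, Averaging P j G} (hav : ∀ j, AvgAC (av j).avg)
  (νs : ∀ k, Measure (GaugeField P k G)) (h0 : νs 0 = 0)
  (hsucc : ∀ k, νs (k + 1) = (fieldMeasure P k G + νs k).map (av k).avg - fieldMeasure P (k + 1) G)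
include hav h0 hsucc

/-- ★★★ **`m_k(triv,·)·dU_k = dU_k + ν♯_k`, `k ≤ m + K + 1`, for every excess-recursive family `ν♯` of file 17 §4** (`ν♯_0 = 0`, `ν♯_{k+1} = (dU_k + ν♯_k)∘Ū_k⁻¹ − dU_{k+1}`).
Induction: `m_0 = 1`; `(dU_k + ν♯_k)∘Ū_k⁻¹ = (m_k(triv)·dU_k)∘Ū_k⁻¹ = (T_k m_k(triv))·dU_{k+1}` EXACTLY (file 25's `withDensity_rnTransport_eq_pushDensity`), so
`dU_{k+1} + ν♯_{k+1} = dU_{k+1} + ((T_k m_k(triv))·dU_{k+1} − 1·dU_{k+1}) = (1 + (T_k m_k(triv) − 1))·dU_{k+1}` (`Measure.withDensity_sub`) `= max(1, T_k m_k(triv))·dU_{k+1} =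
m_{k+1}(triv)·dU_{k+1}` (`add_tsub_eq_max`; the trivial step weight is `1`, `Carriers.stepWeight_triv`).  THE FLOOR IS THE TRUNCATED SUBTRACTION. [cite: Balaban1985UV3, (41) p.266 + (47) p.267 + (2) p.256 (bookkeeping); Balaban1985Averaging, (10) p.19] -/
theorem withDensity_massRecAC_triv_eq_add_excessRec : ∀ k, k ≤ P.m + P.K + 1 →
    (fieldMeasure P k G).withDensity (fun V => ENNReal.ofReal (massRecAC M₁ Rcol εL εS av k (Hist.triv P k) V)) =
      fieldMeasure P k G + νs k
  | 0, _ => by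
    have h1 : (fun V => ENNReal.ofReal (massRecAC M₁ Rcol εL εS av 0 (Hist.triv P 0) V)) = fun _ => (1 : ℝ≥0∞) := by
      funext V; rw [massRecAC_zero]; simp
    rw [h1, withDensity_const, one_smul, h0, add_zero]
  | k + 1, hk => by
    have ih := withDensity_massRecAC_triv_eq_add_excessRec k (by omega)
    have hm0 : ∀ U, 0 ≤ massRecAC M₁ Rcol εL εS av k (Hist.triv P k) U := fun U => massRecAC_nonneg M₁ Rcol εL εS av k _ U
    have hmi : Integrable (massRecAC M₁ Rcol εL εS av k (Hist.triv P k)) (fieldMeasure P k G) := integrable_massRecAC M₁ Rcol εL εS av k _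
    -- the trivial history's integrand is `m_k(triv)` itself (step weight `1` in the range)
    have hw1 : (fun U => stepWeight M₁ Rcol εL εS k (Hist.triv P (k + 1)) U * massRecAC M₁ Rcol εL εS av k (Hist.triv P k) U) =
        massRecAC M₁ Rcol εL εS av k (Hist.triv P k) :=
      funext fun U => by rw [stepWeight_triv M₁ Rcol εL εS (by omega) U, one_mul]
    -- the push-forward of `dU_k + ν♯_k = m_k(triv)·dU_k` is `(T_k m_k(triv))·dU_{k+1}`, exactly
    have hpush : (fieldMeasure P k G + νs k).map (av k).avg =
        (fieldMeasure P (k + 1) G).withDensity (fun V => ENNReal.ofReal (rnTransport (av k).avg (massRecAC M₁ Rcol εL εS av k (Hist.triv P k)) V)) := by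
      rw [← ih, withDensity_rnTransport_eq_pushDensity (hav k) hm0 hmi]
      rfl
    -- the density of `m_{k+1}(triv)` is `max 1 (T m) = 1 + (T m − 1)`
    have hdens : (fun V => ENNReal.ofReal (massRecAC M₁ Rcol εL εS av (k + 1) (Hist.triv P (k + 1)) V)) =
        (fun _ => (1 : ℝ≥0∞)) + ((fun V => ENNReal.ofReal (rnTransport (av k).avg (massRecAC M₁ Rcol εL εS av k (Hist.triv P k)) V)) - fun _ => (1 : ℝ≥0∞)) := by
      funext V
      rw [massRecAC_triv_succ, hw1, ENNReal.ofReal_max, ENNReal.ofReal_one]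
      simp only [Pi.add_apply, Pi.sub_apply]
      exact add_tsub_eq_max.symm
    have hmeasT : Measurable fun V => ENNReal.ofReal (rnTransport (av k).avg (massRecAC M₁ Rcol εL εS av k (Hist.triv P k)) V) :=
      (measurable_rnTransport _ _).ennreal_ofReal
    haveI : IsFiniteMeasure ((fieldMeasure P (k + 1) G).withDensity (fun _ : GaugeField P (k + 1) G => (1 : ℝ≥0∞))) := by
      rw [withDensity_const, one_smul]; infer_instance
    have hone : (fieldMeasure P (k + 1) G).withDensity (fun _ : GaugeField P (k + 1) G => (1 : ℝ≥0∞)) = fieldMeasure P (k + 1) G := by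
      rw [withDensity_const, one_smul]
    rw [hdens, withDensity_add_left measurable_const, Measure.withDensity_sub hmeasT measurable_const, hone, hsucc k, hpush]

/-- ★★ **`ν♯_k = dU_k.withDensity (m_k(triv,·) − 1)`** (truncated subtraction of densities; `k ≤ m + K + 1`): the least weakly-closed family IS the trivial history's excess mass
over the reference measure (subtract `dU_k = 1·dU_k` from §2's identity; `Measure.withDensity_sub`, finiteness). [cite: Balaban1985UV3, (41) p.266 + (47) p.267 (bookkeeping)] -/
theorem excessRec_eq_withDensity_massRecAC_triv_sub_one {k : ℕ} (hk : k ≤ P.m + P.K + 1) :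
    νs k = (fieldMeasure P k G).withDensity ((fun V => ENNReal.ofReal (massRecAC M₁ Rcol εL εS av k (Hist.triv P k) V)) - fun _ => (1 : ℝ≥0∞)) := by
  have hmeas : Measurable fun V => ENNReal.ofReal (massRecAC M₁ Rcol εL εS av k (Hist.triv P k) V) :=
    (measurable_massRecAC M₁ Rcol εL εS av k _).ennreal_ofReal
  haveI : IsFiniteMeasure ((fieldMeasure P k G).withDensity (fun _ : GaugeField P k G => (1 : ℝ≥0∞))) := by
    rw [withDensity_const, one_smul]; infer_instance
  haveI : IsFiniteMeasure (νs k) := isFiniteMeasure_of_excessRec νs h0 hsucc k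
  rw [Measure.withDensity_sub hmeas measurable_const, withDensity_massRecAC_triv_eq_add_excessRec M₁ Rcol εL εS hav νs h0 hsucc k hk,
    withDensity_const, one_smul, add_comm, Measure.add_sub_cancel]

/-- ★★ **THE ANALYTIC TARGET OF FILE 17 ∕ III-b IS THE LETTER AT THE TRIVIAL HISTORY: `ν♯_k ≤ dU_k.withDensity B ⟺ m_k(triv,·) ≤ 1 + B` `dU_k`-a.e.** (in `ℝ≥0∞`:
`ofReal (m_k(triv,V)) ≤ 1 + B V`; `k ≤ m + K + 1`).  (→) §2 + file 16's comparison lemma; (←) `withDensity_mono` + cancellation of the finite `dU_k`. [cite: Balaban1985UV3, (41) p.266 + (47) p.267 (bookkeeping)] -/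
theorem excessRec_le_withDensity_iff_massRecAC_triv_le_ae {k : ℕ} (hk : k ≤ P.m + P.K + 1) (B : GaugeField P k G → ℝ≥0∞) :
    νs k ≤ (fieldMeasure P k G).withDensity B ↔
      ∀ᵐ V ∂(fieldMeasure P k G), ENNReal.ofReal (massRecAC M₁ Rcol εL εS av k (Hist.triv P k) V) ≤ 1 + B V := by
  have hmeas : Measurable fun V => ENNReal.ofReal (massRecAC M₁ Rcol εL εS av k (Hist.triv P k) V) :=
    (measurable_massRecAC M₁ Rcol εL εS av k _).ennreal_ofReal
  have hid := withDensity_massRecAC_triv_eq_add_excessRec M₁ Rcol εL εS hav νs h0 hsucc k hk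
  have h1B : fieldMeasure P k G + (fieldMeasure P k G).withDensity B = (fieldMeasure P k G).withDensity ((fun _ => (1 : ℝ≥0∞)) + B) := by
    rw [withDensity_add_left measurable_const, withDensity_const, one_smul]
  constructor
  · intro hle
    have hle' : (fieldMeasure P k G).withDensity (fun V => ENNReal.ofReal (massRecAC M₁ Rcol εL εS av k (Hist.triv P k) V)) ≤
        (fieldMeasure P k G).withDensity ((fun _ => (1 : ℝ≥0∞)) + B) := by
      rw [hid, ← h1B]; exact add_le_add le_rfl hle
    have h1 := rnDeriv_le_of_le_withDensity hle'
    have h2 := Measure.rnDeriv_withDensity (fieldMeasure P k G) hmeas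
    filter_upwards [h1, h2] with V hV1 hV2
    rw [← hV2]
    exact hV1
  · intro hae
    have hle : fieldMeasure P k G + νs k ≤ fieldMeasure P k G + (fieldMeasure P k G).withDensity B := by
      rw [← hid, h1B]; exact withDensity_mono hae
    exact le_of_add_le_add_left_measure hle

/-- ★★ **EXTENSIVE FORM: `ν♯_k ≤ (e^{c} − 1)·dU_k ⟺ m_k(triv,·) ≤ e^{c}` `dU_k`-a.e.** (`0 ≤ c`; at the [B10] slot `c = c_m·|T₁^{(k)}|`; `k ≤ m + K + 1`) — file 17's ∕ III-b §3's sufficient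
condition for the uniform letter is EQUIVALENT to the letter at the trivial history (hence, by §1, to the uniform letter itself). [cite: Balaban1985UV3, (41) p.266 + (5) p.257 (the extensive shape; bookkeeping)] -/
theorem excessRec_le_smul_iff_massRecAC_triv_le_exp_ae {k : ℕ} (hk : k ≤ P.m + P.K + 1) (c : ℝ) (hc : 0 ≤ c) :
    νs k ≤ ENNReal.ofReal (Real.exp c - 1) • fieldMeasure P k G ↔
      ∀ᵐ V ∂(fieldMeasure P k G), massRecAC M₁ Rcol εL εS av k (Hist.triv P k) V ≤ Real.exp c := by
  have hb0 : 0 ≤ Real.exp c - 1 := by linarith [Real.add_one_le_exp c]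
  rw [← withDensity_const, excessRec_le_withDensity_iff_massRecAC_triv_le_ae M₁ Rcol εL εS hav νs h0 hsucc hk]
  refine Filter.eventually_congr (Filter.Eventually.of_forall fun V => ?_)
  have hm0 := massRecAC_nonneg M₁ Rcol εL εS av k (Hist.triv P k) V
  rw [← ENNReal.ofReal_one, ← ENNReal.ofReal_add zero_le_one hb0, ENNReal.ofReal_le_ofReal_iff (by linarith), add_sub_cancel]

/-- **CONSISTENCY: file 17 §2 at `ν♯` recovers §1 in measure currency** — the weak-closure reduction `m_k(h,·)·dU_k ≤ dU_k + ν♯_k` with §2's identity reads `m_k(h,·)·dU_k ≤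
m_k(triv,·)·dU_k` (`k ≤ m + K + 1`; only measurability of `Ū` enters this route). [cite: Balaban1985UV3, (41) p.266 (bookkeeping)] -/
theorem withDensity_massRecAC_le_withDensity_triv {k : ℕ} (hk : k ≤ P.m + P.K + 1) (h : Hist P k) :
    (fieldMeasure P k G).withDensity (fun V => ENNReal.ofReal (massRecAC M₁ Rcol εL εS av k h V)) ≤
      (fieldMeasure P k G).withDensity (fun V => ENNReal.ofReal (massRecAC M₁ Rcol εL εS av k (Hist.triv P k) V)) := by
  rw [withDensity_massRecAC_triv_eq_add_excessRec M₁ Rcol εL εS hav νs h0 hsucc k hk]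
  exact withDensity_massRecAC_le_of_weakClosed M₁ Rcol εL εS av hav k νs (fun j _ => weakClosed_of_excessRec νs h0 hsucc j) k le_rfl h

/-- ★ **IN `L¹` THERE IS NO STACKING**: `∫⁻ m_k(triv,·) dU_k = 1 + ν♯_k(univ) ≤ 1 + Σ_{j<k} (dU_j∘Ū_j⁻¹ − dU_{j+1})(univ)` (`k ≤ m + K + 1`) — the floored iterate's `L¹`-excess over the
reference density is at most the SUM of the one-step excess masses of the averagings over Haar (each `≤ 1`; `= 0` under E6′; file 17's `excessRec_univ_le` with §2's identity).  The
node's letter asks the SUP-excess to be `≤ e^{c_m|T₁^{(k)}|} − 1`; in `L¹` the defect accumulates at most additively across levels. [cite: Balaban1985UV3, (41) p.266 + (47) p.267; Balaban1985Averaging, (13)+(15) p.19 (bookkeeping)] -/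
theorem lintegral_massRecAC_triv_le {k : ℕ} (hk : k ≤ P.m + P.K + 1) :
    ∫⁻ V, ENNReal.ofReal (massRecAC M₁ Rcol εL εS av k (Hist.triv P k) V) ∂(fieldMeasure P k G) ≤
      1 + ∑ j ∈ Finset.range k, ((fieldMeasure P j G).map (av j).avg - fieldMeasure P (j + 1) G) Set.univ := by
  have hid := withDensity_massRecAC_triv_eq_add_excessRec M₁ Rcol εL εS hav νs h0 hsucc k hk
  have h1 : ∫⁻ V, ENNReal.ofReal (massRecAC M₁ Rcol εL εS av k (Hist.triv P k) V) ∂(fieldMeasure P k G) = (fieldMeasure P k G + νs k) Set.univ := by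
    rw [← hid, withDensity_apply _ MeasurableSet.univ, Measure.restrict_univ]
  rw [h1, Measure.add_apply, measure_univ]
  exact add_le_add le_rfl (excessRec_univ_le νs h0 hsucc (fun j => (hav j).1) k)

end Excess

/-! ## §3 At the [B10] slot's averaging -/
section Print

open Literature.MathematicalPhysics.QuantumFieldTheory.Balaban1985CMP102.Setting (Scales)
open Literature.MathematicalPhysics.QuantumFieldTheory.Balaban1983to89.B10RunsOfRecord (avOfPrint)
open Literature.MathematicalPhysics.QuantumFieldTheory.Balaban1983to89.Node00 (SU)
open Summit.QuantumFields.YangMills.BalabanUVNodes.N08Thm2AtRecordBridgeInhabited (avgAC_avOfPrint)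
open Summit.QuantumFields.YangMills.BalabanUVNodes.N08MassesACLeastClosedFamily (exists_excessRec)

variable (N : ℕ) [NeZero N] {L : ℕ} (S : Scales L) (M₁ : ℕ) (Rcol : ℕ → ℕ) (εL εS : ℕ → ℝ)

/-- ★★ **AT PRINT'S AVERAGING ON `SU(N)`: `m_k(h,·) ≤ m_k(triv,·)` `dU_k`-a.e. for every history**, every `k ≤ K + 1`, every `N`, every thresholds (the masses are print's
iterated Radon–Nikodym masses `massRecAC … (avOfPrint N S)` along [Balaban1985Averaging] (15); `AvgAC` by `avgAC_avOfPrint`). [cite: Balaban1985UV3, (41) p.266 + (47) p.267; Balaban1985Averaging, (15) p.19] -/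
theorem massRecAC_avOfPrint_le_triv_ae {k : ℕ} (hk : k ≤ S.K + 1) (h : Hist S.P k) :
    massRecAC M₁ Rcol εL εS (avOfPrint N S) k h ≤ᵐ[fieldMeasure S.P k (SU N)] massRecAC M₁ Rcol εL εS (avOfPrint N S) k (Hist.triv S.P k) :=
  massRecAC_le_triv_ae M₁ Rcol εL εS (avOfPrint N S) (avgAC_avOfPrint N L S) k (by show k ≤ S.m + S.K + 1; omega) h

/-- ★★ **AT PRINT'S AVERAGING: the history-uniform letter «`massRecAC … (avOfPrint N S) k h ≤ B` a.e. ∀h» ⟺ the letter at `h = triv`** (`k ≤ K + 1`; e.g. `B = e^{c_m|T₁^{(k)}|}`, the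
antecedent of III-b §2). [cite: Balaban1985UV3, (5) p.257 + (41) p.266; Balaban1985Averaging, (15) p.19] -/
theorem massBound_avOfPrint_all_iff_triv {k : ℕ} (hk : k ≤ S.K + 1) (B : GaugeField S.P k (SU N) → ℝ) :
    (∀ h : Hist S.P k, ∀ᵐ V ∂(fieldMeasure S.P k (SU N)), massRecAC M₁ Rcol εL εS (avOfPrint N S) k h V ≤ B V) ↔
      ∀ᵐ V ∂(fieldMeasure S.P k (SU N)), massRecAC M₁ Rcol εL εS (avOfPrint N S) k (Hist.triv S.P k) V ≤ B V :=
  massBound_all_iff_triv M₁ Rcol εL εS (avOfPrint N S) (avgAC_avOfPrint N L S) (by show k ≤ S.m + S.K + 1; omega) B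

/-- ★★ **AT PRINT'S AVERAGING: `m_k(triv,·)·dU_k = dU_k + ν♯_k`** for every excess-recursive family `ν♯` along (15) (such families exist: file 17's `exists_excessRec`), `k ≤ K + 1`.
[cite: Balaban1985UV3, (41) p.266 + (47) p.267 + (2) p.256; Balaban1985Averaging, (15) p.19] -/
theorem withDensity_massRecAC_triv_avOfPrint_eq_add_excessRec (νs : ∀ k, Measure (GaugeField S.P k (SU N))) (h0 : νs 0 = 0)
    (hsucc : ∀ k, νs (k + 1) = (fieldMeasure S.P k (SU N) + νs k).map (avOfPrint N S k).avg - fieldMeasure S.P (k + 1) (SU N))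
    {k : ℕ} (hk : k ≤ S.K + 1) :
    (fieldMeasure S.P k (SU N)).withDensity (fun V => ENNReal.ofReal (massRecAC M₁ Rcol εL εS (avOfPrint N S) k (Hist.triv S.P k) V)) =
      fieldMeasure S.P k (SU N) + νs k :=
  withDensity_massRecAC_triv_eq_add_excessRec M₁ Rcol εL εS (avgAC_avOfPrint N L S) νs h0 hsucc k (by show k ≤ S.m + S.K + 1; omega)

/-- ★★ **AT PRINT'S AVERAGING, EXTENSIVE FORM: `ν♯_k ≤ (e^{c_m|T₁^{(k)}|} − 1)·dU_k ⟺ massRecAC … (avOfPrint N S) k triv ≤ e^{c_m|T₁^{(k)}|}` a.e.** (`0 ≤ c_m`, `k ≤ K + 1`) — III-b §3's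
weakly-closed-family antecedent at the least family and III-b §2's letter at the trivial history are the same statement. [cite: Balaban1985UV3, (5) p.257 + (41) p.266; Balaban1985Averaging, (15) p.19] -/
theorem excessRec_avOfPrint_le_smul_iff_triv_le_exp_ae (νs : ∀ k, Measure (GaugeField S.P k (SU N))) (h0 : νs 0 = 0)
    (hsucc : ∀ k, νs (k + 1) = (fieldMeasure S.P k (SU N) + νs k).map (avOfPrint N S k).avg - fieldMeasure S.P (k + 1) (SU N))
    {k : ℕ} (hk : k ≤ S.K + 1) (cm : ℝ) (hcm : 0 ≤ cm) :
    νs k ≤ ENNReal.ofReal (Real.exp (cm * S.sites k) - 1) • fieldMeasure S.P k (SU N) ↔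
      ∀ᵐ V ∂(fieldMeasure S.P k (SU N)), massRecAC M₁ Rcol εL εS (avOfPrint N S) k (Hist.triv S.P k) V ≤ Real.exp (cm * S.sites k) :=
  excessRec_le_smul_iff_massRecAC_triv_le_exp_ae M₁ Rcol εL εS (avgAC_avOfPrint N L S) νs h0 hsucc (by show k ≤ S.m + S.K + 1; omega) _
    (mul_nonneg hcm (Summit.QuantumFields.Balaban3D.Proofs.ScalesArithmetic.sites_nonneg S k))

end Print

end Summit.QuantumFields.YangMills.BalabanUVNodes.N08TrivialHistoryDominates

end
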